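import Mathlib
import Summits.Ventures.PercRepro.TriangleCapBipartiteResidue
import Summits.Ventures.PercRepro.TriangleCapNestedWitness

/-!
# PercRepro — THE NEAR-REGULAR CONFIGURATION `(D^m, r)` ON BOTH SIDES: THE ENDS, THE CLASSES, THE COLLISION COUNT
(p3, gen 55; part 303)

For `t = m D + r` with `2 ≤ D ≤ m`, `r < D`: the `D`-regular circulant of part 296 on the non-neighbours `1, …, m` and
the leaves `ℓ + 1, …, ℓ + m` (the pair `(a, j)`, `a < m`, `j < D`, joins `1 + a` to `ℓ + 1 + ((a + j) mod m)`) with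
its `r` diagonal pairs `(a, 0)`, `a < r`, REDIRECTED to the new leaf `ℓ + 1 + m`, plus `r` new pairs joining the new
non-neighbour `1 + m` to the leaves `ℓ + 1 + b`, `b < r` (`lfNest`, `rfNR`): every old non-neighbour and every old
leaf keeps `D` pairs, the new ones carry `r` each — the degree sequence `(D^m, r)` on both sides.  Its collision
count is `2 (m D (D − 1) + r (r − 1))` and `coll + 2 r (D − r) = 2 t (D − 1)`, so the band value is
`2 j + 2 t (D − 1) = t (t − 1) + 2 r (D − r) = t (t − 1) + 2 φ_D(t)` (`nearRegularWitness`) — the residue bound of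
part 302 is attained.

This module holds the index functions and the class counts (`rfNR`, `rfNR_bounds`, `goodEnds_nr`, `card_circ_class`,
`cls_rfNR_old`, `cls_rfNR_new`, `coll_rfNR`, `nr_coll_add_phi`); part 307 (TriangleCapNearRegular) assembles the witness
and THE EXACT BOTTOM OF THE DEEP SUB-BAND ON THE BIPARTITE GRAPHS OF THE BAND for `t ≥ D²`, every `ℓ`.
Axioms: standard.
-/

namespace PercRepro

namespace TriangleCap

namespace C047

open Finset

/-- The right ends of the near-regular witness: the circulant leaf `ℓ + 1 + ((⌊i/D⌋ + i mod D) mod m)` for `i < m D`,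
except the diagonal pairs `i = a D`, `a < r`, sent to the new leaf `ℓ + 1 + m`; the new pairs `m D + b`, `b < r`, go to
the leaf `ℓ + 1 + b`. -/
def rfNR (ℓ m r D i : ℕ) : ℕ :=
  if i < m * D then (if i % D = 0 ∧ i / D < r then ℓ + 1 + m else ℓ + 1 + (i / D + i % D) % m)
  else ℓ + 1 + (i - m * D)

/-- The bounds of `rfNR`: `ℓ + 1 ≤ rfNR i ≤ ℓ + 1 + m` for `i < m D + r`, `r ≤ m`. -/
theorem rfNR_bounds (ℓ m r D i : ℕ) (hm : 0 < m) (hrm : r ≤ m) (hi : i < m * D + r) :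
    ℓ + 1 ≤ rfNR ℓ m r D i ∧ rfNR ℓ m r D i ≤ ℓ + 1 + m := by
  unfold rfNR
  split_ifs with h1 h2
  · omega
  · have := Nat.mod_lt (i / D + i % D) hm
    omega
  · omega

/-- The circulant row of the pair `(a, j)`: `(a + j) mod m`. -/
theorem circ_row_eq (m D a j : ℕ) (hD : 0 < D) (hj : j < D) :
    ((a * D + j) / D + (a * D + j) % D) % m = (a + j) % m := by
  obtain ⟨h1, h2⟩ := div_mod_of_lt D a j hD hj
  rw [h1, h2]

/-- The ends of the near-regular witness are good (`2 ≤ D ≤ m`, `r < D`, `m + 1 ≤ ℓ`, `2 t ≤ s`). -/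
theorem goodEnds_nr (s ℓ m r D : ℕ) (hD : 2 ≤ D) (hDm : D ≤ m) (hr : r < D) (hmℓ : m + 1 ≤ ℓ)
    (hs : 2 * (m * D + r) ≤ s) :
    GoodEnds (ℓ + 1 + (s - (m * D + r))) (ℓ + 1) (m * D + r) (lfNest D) (rfNR ℓ m r D) := by
  have hm : 0 < m := by omega
  have hD0 : 0 < D := by omega
  have htℓ : m * D + r ≤ ℓ * D := by
    have : (m + 1) * D ≤ ℓ * D := Nat.mul_le_mul_right D hmℓ
    rw [Nat.succ_mul] at this
    omega
  have hst : m + 1 ≤ s - (m * D + r) := by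
    have : 2 * m ≤ m * D := by nlinarith
    omega
  refine ⟨fun i hi => ?_, fun i hi => ?_, fun i i' hi hi' h1 h2 => ?_⟩
  · have := lfNest_bounds (m * D + r) ℓ D i hD0 htℓ hi
    omega
  · have := rfNR_bounds ℓ m r D i hm (by omega) hi
    omega
  · unfold lfNest at h1
    have hdiv : i / D = i' / D := by omega
    unfold rfNR at h2
    by_cases hi1 : i < m * D <;> by_cases hi2 : i' < m * D
    · -- both in the circulant part: `a = a'`, `j, j' < D ≤ m` with the same class
      obtain ⟨a, j, ha, hj, hij, hia, hib⟩ := index_split D m i hD0 hi1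
      obtain ⟨a', j', ha', hj', hij', hia', hib'⟩ := index_split D m i' hD0 hi2
      rw [if_pos hi1, if_pos hi2, hia, hib, hia', hib'] at h2
      rw [hia, hia'] at hdiv
      subst hdiv
      by_cases hr1 : j = 0 ∧ a < r <;> by_cases hr2 : j' = 0 ∧ a < r
      · omega
      · rw [if_pos hr1, if_neg hr2] at h2
        have := Nat.mod_lt (a + j') hm
        omega
      · rw [if_neg hr1, if_pos hr2] at h2
        have := Nat.mod_lt (a + j) hm
        omega
      · rw [if_neg hr1, if_neg hr2] at h2
        have hjj : j = j' := by
          rcases mod_two_cases m (a + j) hm (by omega) with ⟨h3, h4⟩ | ⟨h3, h4⟩ <;>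
            rcases mod_two_cases m (a + j') hm (by omega) with ⟨h5, h6⟩ | ⟨h5, h6⟩ <;> omega
        omega
    · -- `i` in the circulant part, `i'` new: the columns differ
      have : i / D < m := by
        rw [Nat.div_lt_iff_lt_mul hD0]
        exact hi1
      have : i' / D = m := by
        rw [Nat.div_eq_iff hD0]
        omega
      omega
    · have : i' / D < m := by
        rw [Nat.div_lt_iff_lt_mul hD0]
        exact hi2
      have : i / D = m := by
        rw [Nat.div_eq_iff hD0]
        omega
      omega
    · rw [if_neg hi1, if_neg hi2] at h2
      omega

/-- The circulant class of the leaf `ℓ + 1 + b` (`b < m`): the `D` pairs `(a, j)` with `a + j ≡ b (mod m)`, in the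
index form `(⌊i/D⌋ + i mod D) mod m = b`. -/
theorem card_circ_class (m D b : ℕ) (hD : 0 < D) (hDm : D ≤ m) (hb : b < m) :
    ((range (m * D)).filter (fun i => (i / D + i % D) % m = b)).card = D := by
  have h := cls_rfCirc 0 m D b hD hDm hb
  have e : (range (m * D)).filter (fun i => rfCirc 0 m D i = 0 + 1 + b) =
      (range (m * D)).filter (fun i => (i / D + i % D) % m = b) := by
    apply filter_congr
    intro i _
    unfold rfCirc
    omega
  rw [← e, h]

/-- The class of the old leaf `ℓ + 1 + b` (`b < m`) in the near-regular witness: `D` pairs — the circulant class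
minus the redirected diagonal pair `(b, 0)` when `b < r`, plus the new pair `m D + b` when `b < r`. -/
theorem cls_rfNR_old (ℓ m r D b : ℕ) (hD : 0 < D) (hDm : D ≤ m) (hr : r < D) (hb : b < m) :
    ((range (m * D + r)).filter (fun i => rfNR ℓ m r D i = ℓ + 1 + b)).card = D := by
  have hm : 0 < m := by omega
  set G := (range (m * D)).filter (fun i => (i / D + i % D) % m = b) with hG
  have hGcard : G.card = D := card_circ_class m D b hD hDm hb
  by_cases hbr : b < r
  · -- the diagonal pair `b D` leaves, the new pair `m D + b` enters
    have hmem : b * D ∈ G := by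
      rw [hG, mem_filter, mem_range]
      refine ⟨by nlinarith, ?_⟩
      obtain ⟨h1, h2⟩ := div_mod_of_lt D b 0 hD hD
      rw [add_zero] at h1 h2
      rw [h1, h2, add_zero, Nat.mod_eq_of_lt hb]
    have hset : (range (m * D + r)).filter (fun i => rfNR ℓ m r D i = ℓ + 1 + b) =
        insert (m * D + b) (G.erase (b * D)) := by
      ext i
      simp only [mem_filter, mem_range, mem_insert, mem_erase, hG]
      unfold rfNR
      constructor
      · rintro ⟨hi, hv⟩
        by_cases hi1 : i < m * D
        · rw [if_pos hi1] at hv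
          right
          by_cases hd : i % D = 0 ∧ i / D < r
          · rw [if_pos hd] at hv
            omega
          · rw [if_neg hd] at hv
            refine ⟨?_, hi1, by omega⟩
            intro hib
            apply hd
            rw [hib]
            obtain ⟨h1, h2⟩ := div_mod_of_lt D b 0 hD hD
            rw [add_zero] at h1 h2
            exact ⟨h2, by rw [h1]; exact hbr⟩
        · rw [if_neg hi1] at hv
          left
          omega
      · rintro (rfl | ⟨hne, hi, hcl⟩)
        · refine ⟨by omega, ?_⟩
          rw [if_neg (by omega)]
          omega
        · refine ⟨by omega, ?_⟩
          rw [if_pos hi]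
          have hd : ¬ (i % D = 0 ∧ i / D < r) := by
            rintro ⟨h0, hlt⟩
            apply hne
            have hdm := Nat.div_add_mod i D
            rw [h0, add_zero] at hdm
            rw [h0, add_zero, Nat.mod_eq_of_lt (by omega)] at hcl
            rw [← hdm, hcl, mul_comm]
          rw [if_neg hd]
          omega
    rw [hset, card_insert_of_notMem (by
      rw [mem_erase, hG, mem_filter, mem_range]
      omega), card_erase_of_mem hmem, hGcard]
    omega
  · -- no diagonal pair of the class is redirected, no new pair lands in the class
    have hset : (range (m * D + r)).filter (fun i => rfNR ℓ m r D i = ℓ + 1 + b) = G := by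
      ext i
      simp only [mem_filter, mem_range, hG]
      unfold rfNR
      constructor
      · rintro ⟨hi, hv⟩
        by_cases hi1 : i < m * D
        · rw [if_pos hi1] at hv
          by_cases hd : i % D = 0 ∧ i / D < r
          · rw [if_pos hd] at hv
            omega
          · rw [if_neg hd] at hv
            exact ⟨hi1, by omega⟩
        · rw [if_neg hi1] at hv
          omega
      · rintro ⟨hi, hcl⟩
        refine ⟨by omega, ?_⟩
        rw [if_pos hi]
        have hd : ¬ (i % D = 0 ∧ i / D < r) := by
          rintro ⟨h0, hlt⟩
          rw [h0, add_zero, Nat.mod_eq_of_lt (by omega)] at hcl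
          omega
        rw [if_neg hd]
        omega
    rw [hset, hGcard]

/-- The class of the new leaf `ℓ + 1 + m`: the `r` redirected diagonal pairs `a D`, `a < r`. -/
theorem cls_rfNR_new (ℓ m r D : ℕ) (hD : 0 < D) (hDm : D ≤ m) (hr : r < D) :
    ((range (m * D + r)).filter (fun i => rfNR ℓ m r D i = ℓ + 1 + m)).card = r := by
  have hm : 0 < m := by omega
  have hset : (range (m * D + r)).filter (fun i => rfNR ℓ m r D i = ℓ + 1 + m) =
      (range r).image (fun a => a * D) := by
    ext i
    simp only [mem_filter, mem_range, mem_image]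
    unfold rfNR
    constructor
    · rintro ⟨hi, hv⟩
      by_cases hi1 : i < m * D
      · rw [if_pos hi1] at hv
        by_cases hd : i % D = 0 ∧ i / D < r
        · refine ⟨i / D, hd.2, ?_⟩
          have := Nat.div_add_mod i D
          rw [hd.1, add_zero] at this
          rw [mul_comm]
          exact this
        · rw [if_neg hd] at hv
          have := Nat.mod_lt (i / D + i % D) hm
          omega
      · rw [if_neg hi1] at hv
        omega
    · rintro ⟨a, ha, rfl⟩
      obtain ⟨h1, h2⟩ := div_mod_of_lt D a 0 hD hD
      rw [add_zero] at h1 h2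
      have hlt : a * D < m * D := Nat.mul_lt_mul_of_pos_right (by omega) hD
      refine ⟨by omega, ?_⟩
      rw [if_pos hlt, if_pos ⟨h2, by rw [h1]; exact ha⟩]
  rw [hset, card_image_of_injOn (fun x _ y _ h => Nat.eq_of_mul_eq_mul_right hD h), card_range]

/-- `coll t rfNR = m D (D − 1) + r (r − 1)` for `t = m D + r`. -/
theorem coll_rfNR (ℓ m r D : ℕ) (hD : 0 < D) (hDm' : D ≤ m) (hr : r < D) :
    coll (m * D + r) (rfNR ℓ m r D) = m * (D * (D - 1)) + r * (r - 1) := by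
  have hm : 0 < m := by omega
  rw [coll_eq_sum_cls (m * D + r) (rfNR ℓ m r D) ((range (m + 1)).image (fun b => ℓ + 1 + b)) (fun i hi => by
    rw [mem_image]
    have := rfNR_bounds ℓ m r D i hm (by omega) hi
    exact ⟨rfNR ℓ m r D i - (ℓ + 1), mem_range.mpr (by omega), by omega⟩)]
  rw [sum_image (fun b _ b' _ h => by omega), sum_range_succ]
  unfold cls
  rw [cls_rfNR_new ℓ m r D hD hDm' hr]
  congr 1
  rw [sum_const_nat (m := D * (D - 1)) (fun b hb => by
    rw [cls_rfNR_old ℓ m r D b hD hDm' hr (mem_range.mp hb)]), card_range]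

/-- **THE VALUE IDENTITY:** `2 (m D (D − 1) + r (r − 1)) + 2 r (D − r) = 2 t (D − 1)` for `t = m D + r`. -/
theorem nr_coll_add_phi (m r D : ℕ) (hr : r < D) :
    2 * (m * (D * (D - 1)) + r * (r - 1)) + 2 * (r * (D - r)) = 2 * ((m * D + r) * (D - 1)) := by
  obtain ⟨e, rfl⟩ : ∃ e, D = r + e + 1 := ⟨D - r - 1, by omega⟩
  have e1 : r + e + 1 - 1 = r + e := by omega
  have e2 : r + e + 1 - r = e + 1 := by omega
  rw [e1, e2]
  rcases r with _ | r
  · ring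
  · rw [Nat.add_sub_cancel]
    ring

end C047

end TriangleCap

end PercRepro
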